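import Summits.RiemannHypothesis.RiemannHypothesis.Theorems.HandoffCrossArch
import HarnessLib

/-!
# HANDOFF — TRANSLATED KERNELS: Mellin, polar, prime and archimedean terms of `k(· ∓ L)` (cell rh-explicit, TRACK «HANDOFF», seat prove-2, ATTEMPT-14, part 1/3)

HONEST FRAMING. Nothing here bears on the truth of RH. RH-free bookkeeping for idea-3's UV-FLOOR lemma of the handoff
capacity (hand-off P-G14-1, PART G14 of `HOME/handoff/IDEAS-finite-rank.md`; consumers: `HandoffTranslatePair.lean`,
`HandoffCapacityUVFloor.lean`). For a test kernel `k` and a shift `h` (later `h = ±L`, `L = log q`), all PROVED: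

* `weilMellin_comp_sub`: `(k(· − h))^(s) = e^{(s − ½)h}·k̂(s)`; `weilPolarTerm_comp_sub_add_comp_add`: the polar terms of the two
  opposite translates `k(· ∓ 2c)` sum to `(e^{c} + e^{−c})·polar(k)`;
* `weilPrimeTerm_eq_single`: a kernel meeting only the atom `q` has prime term `(Λ(q)/√q)(K(log q) + K(−log q))`;
  `inv_succ_le_abs_log_sub_log`: `|log n − log q| ≥ 1/(q+1)` for integers `n ≠ q`; `translate_log_vanish`: a kernel supported in
  `|s| ≤ ρ < 1/(q+1)`, shifted to `±log q`, meets no prime power but `q`;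
* `norm_weilArchTerm_le_of_lag_support`: the archimedean term (Bombieri's form) of a kernel living on lags `|y| ∈ [2c′, 2b]` is
  `≤ 2(b − c′)·M(c′)·sup_{t>0}‖K(t) + K(−t)‖`, `M = archGapBound` — the tree's `norm_weilArchTerm_cross_le` (`HandoffCrossArch.lean`)
  un-specialised from cross kernels of two lobes to any lag-supported kernel;
* `weilConv_translate_weilReflect_translate`: `θ(· − a) ⋆ (θ(· − a′))~ = k_θ(· − (a − a′))`; `weilConv_weilReflect_const_mul`.

References (as printed): E. Bombieri, Rend. Mat. Acc. Lincei (9) 11 (2000) Thm 2 (the three terms of `W`, `x = e^t`) [`Bombieri2000Weil`].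
-/

set_option linter.dupNamespace false

noncomputable section

open Complex Filter Set MeasureTheory Literature.NumberTheory.LFunctions
open scoped Real Topology ComplexConjugate ContDiff ArithmeticFunction.vonMangoldt

namespace Summit.RiemannHypothesis.RiemannHypothesis.Theorems.Handoff

variable {θ k K : ℝ → ℂ} {q : ℕ}

/-! ## §1 Translated kernels -/

/-- Mellin transform of a translate: `(k(· − h))^(s) = e^{(s − ½)h}·k̂(s)` (substitution; no hypotheses). [folklore] -/
theorem weilMellin_comp_sub (k : ℝ → ℂ) (h : ℝ) (s : ℂ) :
    weilMellin (fun y ↦ k (y - h)) s = cexp ((s - 1 / 2) * h) * weilMellin k s := by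
  unfold weilMellin
  have key := integral_sub_right_eq_self (μ := (volume : Measure ℝ))
    (fun t : ℝ ↦ k t * cexp ((s - 1 / 2) * (t + h : ℝ))) h
  simp only [sub_add_cancel] at key
  rw [key, ← integral_const_mul]
  congr 1 with t
  rw [show ((t + h : ℝ) : ℂ) = (t : ℂ) + (h : ℂ) by push_cast; ring, mul_add, Complex.exp_add]
  ring

/-- Translates of a test kernel are test kernels. [folklore] -/
theorem isWeilTest_comp_sub (hk : IsWeilTest k) (h : ℝ) : IsWeilTest fun y ↦ k (y - h) := by
  have e : (fun y ↦ k (y - h)) = fun y ↦ k (y + -h) := by funext y; rw [sub_eq_add_neg]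
  rw [e]
  exact isWeilTest_recentre hk (-h)

/-- Support of a translate: `tsupport k ⊆ [a, b] ⟹ tsupport k(· − h) ⊆ [a + h, b + h]`. [folklore] -/
theorem tsupport_comp_sub_subset {a b : ℝ} (hk : tsupport k ⊆ Icc a b) (h : ℝ) :
    tsupport (fun y ↦ k (y - h)) ⊆ Icc (a + h) (b + h) := by
  intro x hx
  have hφ : Continuous (fun y : ℝ ↦ y - h) := continuous_id.sub continuous_const
  have hx' : x ∈ (fun y : ℝ ↦ y - h) ⁻¹' tsupport k :=
    tsupport_comp_subset_preimage_of_continuous k hφ (by simpa [Function.comp_def] using hx)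
  have hmem := hk hx'
  simp only [Set.mem_Icc] at hmem
  exact ⟨by linarith [hmem.1], by linarith [hmem.2]⟩

/-- **The polar terms of the two opposite translates** `k(· − 2c)`, `k(· + 2c)` sum to `(e^{c} + e^{−c})·polar(k)`. [folklore] -/
theorem weilPolarTerm_comp_sub_add_comp_add (k : ℝ → ℂ) (c : ℝ) :
    weilPolarTerm (fun y ↦ k (y - 2 * c)) + weilPolarTerm (fun y ↦ k (y + 2 * c)) =
      ((Real.exp c + Real.exp (-c) : ℝ) : ℂ) * weilPolarTerm k := by
  have e : (fun y ↦ k (y + 2 * c)) = fun y ↦ k (y - (-(2 * c))) := by funext y; rw [sub_neg_eq_add]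
  rw [e]
  unfold weilPolarTerm
  rw [weilMellin_comp_sub, weilMellin_comp_sub, weilMellin_comp_sub, weilMellin_comp_sub]
  have h0 : cexp ((0 - 1 / 2) * ((2 * c : ℝ) : ℂ)) = (Real.exp (-c) : ℂ) := by
    rw [Complex.ofReal_exp]; congr 1; push_cast; ring
  have h1 : cexp ((1 - 1 / 2) * ((2 * c : ℝ) : ℂ)) = (Real.exp c : ℂ) := by
    rw [Complex.ofReal_exp]; congr 1; push_cast; ring
  have h0' : cexp ((0 - 1 / 2) * ((-(2 * c) : ℝ) : ℂ)) = (Real.exp c : ℂ) := by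
    rw [Complex.ofReal_exp]; congr 1; push_cast; ring
  have h1' : cexp ((1 - 1 / 2) * ((-(2 * c) : ℝ) : ℂ)) = (Real.exp (-c) : ℂ) := by
    rw [Complex.ofReal_exp]; congr 1; push_cast; ring
  rw [h0, h1, h0', h1']
  push_cast
  ring

/-- **Prime term of a kernel meeting only the atom `q`**: if `K(±log n) = 0` for every `n ≠ q` then
`prime(K) = (Λ(q)/√q)·(K(log q) + K(−log q))`. [cite: Bombieri2000Weil, Thm 2 (prime side)] -/
theorem weilPrimeTerm_eq_single (q : ℕ) (hK : ∀ n : ℕ, n ≠ q → K (Real.log n) = 0 ∧ K (-Real.log n) = 0) :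
    weilPrimeTerm K = ((Λ q : ℝ) : ℂ) / (Real.sqrt q : ℂ) * (K (Real.log q) + K (-Real.log q)) := by
  unfold weilPrimeTerm
  exact tsum_eq_single q fun n hn ↦ by rw [(hK n hn).1, (hK n hn).2, add_zero, mul_zero]

/-- **Integer logarithms are separated**: for `1 ≤ q`, `1 ≤ n`, `n ≠ q`: `1/(q+1) ≤ |log n − log q|`
(`log(1 + 1/m) ≥ 1/(m+1)`). [folklore] -/
theorem inv_succ_le_abs_log_sub_log {q n : ℕ} (hq : 1 ≤ q) (hn : 1 ≤ n) (hne : n ≠ q) :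
    1 / ((q : ℝ) + 1) ≤ |Real.log n - Real.log q| := by
  have hn0 : (0 : ℝ) < n := by exact_mod_cast hn
  have hq0 : (0 : ℝ) < q := by exact_mod_cast hq
  rcases lt_or_gt_of_ne hne with h | h
  · -- `n < q`: `log q − log n = log (q/n) ≥ 1 − n/q = (q − n)/q ≥ 1/q ≥ 1/(q+1)`
    have hnq : (n : ℝ) + 1 ≤ q := by exact_mod_cast h
    have hle : Real.log n ≤ Real.log q := Real.log_le_log hn0 (by linarith)
    rw [abs_sub_comm, abs_of_nonneg (by linarith), ← Real.log_div hq0.ne' hn0.ne']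
    have h1 : 1 - ((q : ℝ) / n)⁻¹ ≤ Real.log (q / n) := Real.one_sub_inv_le_log_of_pos (by positivity)
    rw [inv_div] at h1
    have h2 : 1 - (n : ℝ) / q = ((q : ℝ) - n) / q := by field_simp
    have h3 : (1 : ℝ) / q ≤ ((q : ℝ) - n) / q := div_le_div_of_nonneg_right (by linarith) hq0.le
    have h4 : 1 / ((q : ℝ) + 1) ≤ 1 / (q : ℝ) := one_div_le_one_div_of_le hq0 (by linarith)
    linarith
  · -- `q < n`: `log n − log q = log (n/q) ≥ 1 − q/n ≥ 1 − q/(q+1) = 1/(q+1)`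
    have hqn : (q : ℝ) + 1 ≤ n := by exact_mod_cast h
    have hle : Real.log q ≤ Real.log n := Real.log_le_log hq0 (by linarith)
    rw [abs_of_nonneg (by linarith), ← Real.log_div hn0.ne' hq0.ne']
    have h1 : 1 - ((n : ℝ) / q)⁻¹ ≤ Real.log (n / q) := Real.one_sub_inv_le_log_of_pos (by positivity)
    rw [inv_div] at h1
    have h2 : (q : ℝ) / n ≤ q / (q + 1) := div_le_div_of_nonneg_left hq0.le (by positivity) hqn
    have h3 : 1 - (q : ℝ) / (q + 1) = 1 / ((q : ℝ) + 1) := by field_simp; ring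
    linarith

/-- A kernel vanishing outside `|s| ≤ ρ` with `ρ < 1/(q+1)` (`q ≥ 2`), translated to `±log q`, meets no prime power but `q`:
for `n ≠ q` all of `k(log n − log q)`, `k(−log n − log q)`, `k(log n + log q)`, `k(−log n + log q)` vanish, and so do
`k(±log q)`, `k(±2 log q)`. [folklore] -/
theorem translate_log_vanish (hq : 2 ≤ q) {ρ : ℝ} (hρ : ρ < 1 / ((q : ℝ) + 1))
    (hk : ∀ s : ℝ, ρ < |s| → k s = 0) :
    (∀ n : ℕ, n ≠ q →
      (k (Real.log n - Real.log q) = 0 ∧ k (-Real.log n - Real.log q) = 0) ∧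
      (k (Real.log n + Real.log q) = 0 ∧ k (-Real.log n + Real.log q) = 0)) ∧
    (k (Real.log q) = 0 ∧ k (-Real.log q) = 0) ∧
    (k (2 * Real.log q) = 0 ∧ k (-(2 * Real.log q)) = 0) := by
  have hq1 : 1 ≤ q := by omega
  have hq0 : (0 : ℝ) < q := by exact_mod_cast (by omega : 0 < q)
  have hq2 : (2 : ℝ) ≤ q := by exact_mod_cast hq
  -- `ρ < 1/(q+1) ≤ 1/3 < log 2 ≤ log q`
  have hρ3 : ρ < 1 / 3 := hρ.trans_le (by rw [div_le_div_iff₀ (by positivity) (by norm_num)]; linarith)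
  have hlog2 : (1 : ℝ) / 3 < Real.log 2 := by
    have := Real.log_two_gt_d9; norm_num at this ⊢; linarith
  have hL : Real.log 2 ≤ Real.log q := Real.log_le_log (by norm_num) hq2
  have hLρ : ρ < Real.log q := by linarith
  have hL0 : 0 ≤ Real.log q := Real.log_nonneg (by linarith)
  refine ⟨fun n hn ↦ ?_, ⟨hk _ ?_, hk _ ?_⟩, ⟨hk _ ?_, hk _ ?_⟩⟩
  · rcases Nat.eq_zero_or_pos n with rfl | hn1
    · simp only [Nat.cast_zero, Real.log_zero, zero_sub, neg_zero, zero_add]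
      exact ⟨⟨hk _ (by rwa [abs_neg, abs_of_nonneg hL0]), hk _ (by rwa [abs_neg, abs_of_nonneg hL0])⟩,
        ⟨hk _ (by rwa [abs_of_nonneg hL0]), hk _ (by rwa [abs_of_nonneg hL0])⟩⟩
    · have hsep : ρ < |Real.log n - Real.log q| :=
        (hρ.trans_le (inv_succ_le_abs_log_sub_log hq1 hn1 hn))
      have hlogn : 0 ≤ Real.log n := Real.log_nonneg (by exact_mod_cast hn1)
      refine ⟨⟨hk _ hsep, hk _ ?_⟩, ⟨hk _ ?_, hk _ ?_⟩⟩
      · rw [show -Real.log n - Real.log q = -(Real.log n + Real.log q) by ring, abs_neg,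
          abs_of_nonneg (by linarith)]
        linarith
      · rw [abs_of_nonneg (by linarith)]
        linarith
      · rwa [show -Real.log n + Real.log q = -(Real.log n - Real.log q) by ring, abs_neg]
  · rwa [abs_of_nonneg hL0]
  · rwa [abs_neg, abs_of_nonneg hL0]
  · rw [abs_of_nonneg (by linarith)]; linarith
  · rw [abs_neg, abs_of_nonneg (by linarith)]; linarith

/-- **Archimedean term of a lag-supported kernel** (Bombieri's form): if the test kernel `K` vanishes for `|y| < 2c′`
(`c′ > 0`) and for `|y| > 2b`, and `‖K(t) + K(−t)‖ ≤ N` for `t > 0`, then `‖W_∞(K)‖ ≤ 2(b − c′)·M(c′)·N`,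
`M(c′) = archGapBound c′ ≥ e^{t/2}/(2 sinh t)` on `t ≥ 2c′` (the integrand lives on `t ∈ [2c′, 2b]`, `K(0) = 0`).
[cite: Bombieri2000Weil, Thm 2 (archimedean term, x = e^t)] -/
theorem norm_weilArchTerm_le_of_lag_support (hK : IsWeilTest K) {c' b N : ℝ} (hc' : 0 < c') (hcb : c' ≤ b)
    (hzero : ∀ y : ℝ, |y| < 2 * c' → K y = 0) (hzero' : ∀ y : ℝ, 2 * b < |y| → K y = 0)
    (hbound : ∀ t : ℝ, 0 < t → ‖K t + K (-t)‖ ≤ N) :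
    ‖weilArchTerm K‖ ≤ 2 * (b - c') * archGapBound c' * N := by
  have hK0 : K 0 = 0 := hzero 0 (by rw [abs_zero]; linarith)
  rw [← weilArchTermBombieri_eq_weilArchTerm_holds hK]
  unfold weilArchTermBombieri
  rw [hK0]
  simp only [mul_zero, sub_zero, zero_add, norm_neg]
  have hsub : Icc (2 * c') (2 * b) ⊆ Ioi (0 : ℝ) := fun x hx ↦ lt_of_lt_of_le (by linarith) hx.1
  rw [setIntegral_eq_of_subset_of_forall_sdiff_eq_zero measurableSet_Ioi hsub (fun t ht ↦ by
    have ht0 : 0 < t := ht.1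
    have : K t = 0 ∧ K (-t) = 0 := by
      rcases lt_or_ge t (2 * c') with h1 | h1
      · exact ⟨hzero t (by rwa [abs_of_pos ht0]), hzero (-t) (by rwa [abs_neg, abs_of_pos ht0])⟩
      · have h2 : 2 * b < t := by
          by_contra h2
          exact ht.2 ⟨h1, not_lt.1 h2⟩
        exact ⟨hzero' t (by rwa [abs_of_pos ht0]), hzero' (-t) (by rwa [abs_neg, abs_of_pos ht0])⟩
    rw [this.1, this.2]; simp)]
  have hvol : volume.real (Icc (2 * c') (2 * b)) = 2 * b - 2 * c' := Real.volume_real_Icc_of_le (by linarith)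
  have hbd : ∀ t ∈ Icc (2 * c') (2 * b),
      ‖(Real.exp (t / 2) : ℂ) * (K t + K (-t)) / (2 * Real.sinh t : ℂ)‖ ≤ archGapBound c' * N := by
    intro t ht
    have ht0 : 0 < t := lt_of_lt_of_le (by linarith) ht.1
    have hsh : 0 < Real.sinh t := Real.sinh_pos_iff.2 ht0
    rw [norm_div, norm_mul, Complex.norm_real, Real.norm_eq_abs, abs_of_pos (Real.exp_pos _),
      show ((2 : ℂ) * (Real.sinh t : ℂ)) = ((2 * Real.sinh t : ℝ) : ℂ) by push_cast; ring, Complex.norm_real,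
      Real.norm_eq_abs, abs_of_pos (by positivity)]
    rw [mul_div_right_comm]
    exact mul_le_mul (exp_half_div_two_sinh_le hc' ht.1) (hbound t ht0) (norm_nonneg _) (archGapBound_pos hc').le
  calc ‖∫ t in Icc (2 * c') (2 * b), ((Real.exp (t / 2) : ℂ) * (K t + K (-t))) / (2 * Real.sinh t : ℂ)‖
      ≤ archGapBound c' * N * volume.real (Icc (2 * c') (2 * b)) :=
        norm_setIntegral_le_of_norm_le_const (by rw [Real.volume_Icc]; exact ENNReal.ofReal_lt_top) hbd
    _ = 2 * (b - c') * archGapBound c' * N := by rw [hvol]; ring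

/-! ## §2 Cross kernels of translates -/

/-- Cross kernel of two translates of one profile: `θ(· − a) ⋆ (θ(· − a′))~ = k_θ(· − (a − a′))`. [folklore] -/
theorem weilConv_translate_weilReflect_translate (θ : ℝ → ℂ) (a a' : ℝ) :
    weilConv (fun x ↦ θ (x - a)) (weilReflect fun x ↦ θ (x - a')) =
      fun y ↦ weilConv θ (weilReflect θ) (y - (a - a')) := by
  funext y
  rw [weilConv_weilReflect_eq_integral, weilConv_weilReflect_eq_integral]
  have e : (fun u : ℝ ↦ θ (u - a) * conj (θ (u - y - a'))) =
      fun u : ℝ ↦ (fun v : ℝ ↦ θ v * conj (θ (v - (y - (a - a'))))) (u - a) := by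
    funext u
    simp only
    congr 3
    ring
  rw [e, integral_sub_right_eq_self (fun v : ℝ ↦ θ v * conj (θ (v - (y - (a - a'))))) a]

/-- The autocorrelation kernel scales by `|r|²`: `k_{r g} = |r|² k_g`. [folklore] -/
theorem weilConv_weilReflect_const_mul (r : ℂ) (g : ℝ → ℂ) :
    weilConv (fun t ↦ r * g t) (weilReflect fun t ↦ r * g t) =
      fun t ↦ (Complex.normSq r : ℂ) * weilConv g (weilReflect g) t := by
  funext t
  rw [weilConv_apply, weilConv_apply, ← integral_const_mul]
  congr 1 with u
  simp only [weilReflect, map_mul, Complex.normSq_eq_conj_mul_self]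
  ring

end Summit.RiemannHypothesis.RiemannHypothesis.Theorems.Handoff

end
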